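import Mathlib
import HarnessLib
import Summits.ResolutionOfSingularities.ResolutionOfSingularities.Theorems.WildQuotientsWildQuotientResolutionConductorOneFixedSpan
import Summits.ResolutionOfSingularities.ResolutionOfSingularities.Theorems.WildQuotientsWildQuotientResolutionConductorOneChartAlgebra
import Summits.ResolutionOfSingularities.ResolutionOfSingularities.Theorems.WildQuotientsWildQuotientResolutionPthConeIrrelevant

/-!
# S2 F5b (part 3a): invariance of the cone-monomial images and the cone element `ν`
(crux stmt-ResolutionOfSingularities-15640 `WildQuotients.WildQuotientResolution`, line `Sketch`;
chain w45c post-V5 programme S2, design `L/res-L1-w45c-lead-1/S2-DESIGN.md` v1.1 §7 (7.2)/(7.7),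
res-L1-w45c-plan-1 RULINGs 2026-08-27T16:27:51Z (F5 = lead-1), 17:07:17Z (R2)/(R4), 17:31:45Z (3).
[OURS · L1 W4.5c] — NOT a statement of the manuscript. Lead prover res-L1-w45c-lead-1.)

For the straightened chart ring `M = ChartRing k p n i I` (`i ∈ I`) and ANY `k`-algebra endomorphism
`σ` with the diagonal-Möbius laws (`IsChartAction`; the lifted conductor-𝟙 action is one), with
`R₀ = ↥(PthCone.cone k n p (chartWeight p n I))` the weight-`0` cone and `ν = ConductorOne.coneNu`
the cone element with `ψ₀(ν) = N'` (the invariant norm unit `chartNu`):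

* `sigma_chartU`, `sigma_chartMono`, `sigma_psi0` — every `ψ₀`-image is `σ`-fixed (design (7.2)
  «invariance in one line»: the twist exponent `A(m) − B(m) − p·d(m)` vanishes);
* `coneNuPoly`, `coneNu` (the cone element `ν = ∏(1 − x_i^{p−1}x_l + x_l^p)∏(1 − x_i^{p−1}x_l^{p−1} + x_l^p)`),
  `psi0_eq_sum`, `psi0_coneNu` (`ψ₀(ν) = N'`, stub-3's closed forms), `isUnit_psi0_coneNu`.
The localisation `ψ : R₀[1/ν] → M`, its range (= the fixed points), injectivity and the point-ideal
pull-back are `…ConductorOnePresentation.lean`.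
-/

-- single-problem summit: the doubled namespace component `ResolutionOfSingularities` is forced
set_option linter.dupNamespace false

noncomputable section

open MvPolynomial

namespace Summit.ResolutionOfSingularities.ResolutionOfSingularities.Theorems.WildQuotientResolution.ConductorOne

section Presentation

variable (k : Type) [Field k] (p n : ℕ) (i : Fin n) (I : Finset (Fin n))

/-- `coneMonomial = PthCone.monomialElem` (same element; two files). [OURS · L1 W4.5c] -/
theorem coneMonomial_eq_monomialElem (w : Fin n → ZMod p) (d : Fin n →₀ ℕ) (hd : Finsupp.weight w d = 0) :
    coneMonomial k n p w d hd = PthCone.monomialElem k n p w d hd :=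
  rfl

/-- `twistDeg (a·e_l) = a` for `l ∈ I`. [OURS · L1 W4.5c] -/
theorem twistDeg_single_of_mem {l : Fin n} (hl : l ∈ I) (a : ℕ) :
    twistDeg n I (Finsupp.single l a) = a :=
  twistDeg_single_self n l I hl a

/-- `twistDeg (a·e_l) = −a` for `l ∉ I`. [OURS · L1 W4.5c] -/
theorem twistDeg_single_of_not_mem {l : Fin n} (hl : l ∉ I) (a : ℕ) :
    twistDeg n I (Finsupp.single l a) = -(a : ℤ) := by
  classical
  rw [twistDeg]
  rw [Finset.sum_eq_zero (fun l' hl' => by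
    have : l' ≠ l := fun h => hl (h ▸ hl')
    rw [Finsupp.single_apply, if_neg (Ne.symm this)]; simp)]
  rw [Finset.sum_eq_single_of_mem l (Finset.mem_sdiff.mpr ⟨Finset.mem_univ l, hl⟩) (fun l' _ hl' => by
    rw [Finsupp.single_apply, if_neg (Ne.symm hl')]; simp), Finsupp.single_eq_same]
  ring

/-! ## Invariance of the `ψ₀`-images -/

variable [Fact p.Prime] [CharP k p]
variable (σ : ChartRing k p n i I →ₐ[k] ChartRing k p n i I)
  (hσ : IsChartAction k p n i I (σ : ChartRing k p n i I →+* ChartRing k p n i I))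

include hσ in
/-- `σ u = u · w^p`. [OURS · L1 W4.5c] -/
theorem sigma_chartU :
    σ (1 - chartX k p n i I i ^ (p - 1)) = (1 - chartX k p n i I i ^ (p - 1)) * chartW k p n i I ^ p := by
  haveI := chartRing_charP k p n i I
  have hdeg := one_sub_pow_deg (σ : ChartRing k p n i I →+* ChartRing k p n i I) (chartX k p n i I i) hσ.1 p
  have hW : (1 + chartX k p n i I i) * chartW k p n i I = 1 := one_add_chartS_mul_chartW k p n i I
  calc σ (1 - chartX k p n i I i ^ (p - 1))
      = σ (1 - chartX k p n i I i ^ (p - 1)) * ((1 + chartX k p n i I i) * chartW k p n i I) ^ p := by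
        rw [hW, one_pow, mul_one]
    _ = (σ : ChartRing k p n i I →+* ChartRing k p n i I) (1 - chartX k p n i I i ^ (p - 1)) *
          (1 + chartX k p n i I i) ^ p * chartW k p n i I ^ p := by rw [mul_pow, ← mul_assoc]; rfl
    _ = (1 - chartX k p n i I i ^ (p - 1)) * chartW k p n i I ^ p := by rw [hdeg]

omit [Fact p.Prime] [CharP k p] in
/-- `↑(U^{−d}) = v^d` for `d : ℕ`. [OURS · L1 W4.5c] -/
theorem val_chartUUnit_zpow_neg_natCast (d : ℕ) :
    ((chartUUnit k p n i I ^ (-(d : ℤ)) : (ChartRing k p n i I)ˣ) : ChartRing k p n i I) = chartV k p n i I ^ d := by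
  rw [zpow_neg, zpow_natCast, ← inv_pow, Units.val_pow_eq_pow_val, val_chartUUnit_inv]

omit [Fact p.Prime] [CharP k p] in
/-- `↑(U^{d}) = u^d` for `d : ℕ`. [OURS · L1 W4.5c] -/
theorem val_chartUUnit_zpow_natCast (d : ℕ) :
    ((chartUUnit k p n i I ^ (d : ℤ) : (ChartRing k p n i I)ˣ) : ChartRing k p n i I) =
      (1 - chartX k p n i I i ^ (p - 1)) ^ d := by
  rw [zpow_natCast, Units.val_pow_eq_pow_val, val_chartUUnit]

include hσ in
/-- **The cone-monomial images are `σ`-fixed** (design (7.2) «invariance in one line»: the twist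
exponent `A(m) − B(m) − p·d(m)` vanishes). [OURS · L1 W4.5c] -/
theorem sigma_chartMono (m : Multiplicative (coneMonoid n p (chartWeight p n I))) :
    σ (chartMono k p n i I m) = chartMono k p n i I m := by
  haveI := chartRing_charP k p n i I
  have hm := (mem_coneMonoid_iff n p _ m.toAdd.1).mp m.toAdd.2
  have htw := twistDeg_eq_mul_coneDeg n p I _ hm
  rw [twistDeg_eq_degA_sub_degB] at htw
  have hW : chartW k p n i I * (1 + chartX k p n i I i) = 1 := by
    rw [mul_comm]; exact one_add_chartS_mul_chartW k p n i I
  rw [chartMono_apply, map_mul, sigma_algebraMap_monomial k p n i I σ hσ]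
  set Mo := algebraMap (MvPolynomial (Fin n) k) (ChartRing k p n i I) (monomial m.toAdd.1 1)
  obtain ⟨d, hd | hd⟩ := Int.eq_nat_or_neg (coneDeg n p I m.toAdd.1)
  · -- `d(m) = d ≥ 0`: `A = B + p d`
    have hA : degA n I m.toAdd.1 = degB n I m.toAdd.1 + p * d := by
      have : (degA n I m.toAdd.1 : ℤ) = degB n I m.toAdd.1 + p * d := by rw [hd] at htw; linarith
      exact_mod_cast this
    rw [hd, val_chartUUnit_zpow_neg_natCast, map_pow, sigma_chartV k p n i I σ hσ, hA, mul_pow,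
      ← pow_mul]
    calc Mo * chartW k p n i I ^ (degB n I m.toAdd.1 + p * d) * (1 + chartX k p n i I i) ^ degB n I m.toAdd.1 *
          (chartV k p n i I ^ d * (1 + chartX k p n i I i) ^ (p * d))
        = Mo * chartV k p n i I ^ d * (chartW k p n i I * (1 + chartX k p n i I i)) ^ (degB n I m.toAdd.1 + p * d) := by
          rw [mul_pow, pow_add (1 + chartX k p n i I i)]; ring
      _ = Mo * chartV k p n i I ^ d := by rw [hW, one_pow, mul_one]
  · -- `d(m) = −d ≤ 0`: `A + p d = B`
    have hB : degB n I m.toAdd.1 = degA n I m.toAdd.1 + p * d := by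
      have : (degB n I m.toAdd.1 : ℤ) = degA n I m.toAdd.1 + p * d := by rw [hd] at htw; linarith
      exact_mod_cast this
    rw [hd, neg_neg, val_chartUUnit_zpow_natCast, map_pow, sigma_chartU k p n i I σ hσ, hB, mul_pow,
      ← pow_mul]
    calc Mo * chartW k p n i I ^ degA n I m.toAdd.1 * (1 + chartX k p n i I i) ^ (degA n I m.toAdd.1 + p * d) *
          ((1 - chartX k p n i I i ^ (p - 1)) ^ d * chartW k p n i I ^ (p * d))
        = Mo * (1 - chartX k p n i I i ^ (p - 1)) ^ d *
            (chartW k p n i I * (1 + chartX k p n i I i)) ^ (degA n I m.toAdd.1 + p * d) := by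
          rw [mul_pow, pow_add (1 + chartX k p n i I i)]; ring
      _ = Mo * (1 - chartX k p n i I i ^ (p - 1)) ^ d := by rw [hW, one_pow, mul_one]

include hσ in
/-- Every `ψ₀`-image is `σ`-fixed. [OURS · L1 W4.5c] -/
theorem sigma_psi0 (f : PthCone.cone k n p (chartWeight p n I)) : σ (psi0 k p n i I f) = psi0 k p n i I f := by
  -- `ψ₀ f = lift chartMono (coneAlgEquiv f) = Σ c • chartMono m`
  rw [psi0, AlgHom.comp_apply]
  set g := (coneAlgEquiv k n p (chartWeight p n I)).toAlgHom f
  rw [AddMonoidAlgebra.lift_apply]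
  rw [show (AddMonoidAlgebra.coeff g).sum (fun m c => c • chartMono k p n i I (Multiplicative.ofAdd m)) =
      (AddMonoidAlgebra.coeff g).sum (fun m c => c • chartMono k p n i I (Multiplicative.ofAdd m)) from rfl]
  rw [Finsupp.sum, map_sum]
  refine Finset.sum_congr rfl fun m _ => ?_
  rw [map_smul, sigma_chartMono k p n i I σ hσ]

/-! ## The cone element `ν` and `ψ₀(ν) = N'` -/

/-- The polynomial `∏_{l∈I∖i}(1 − x_i^{p−1}x_l + x_l^p) · ∏_{l∉I}(1 − x_i^{p−1}x_l^{p−1} + x_l^p)`.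
[OURS · L1 W4.5c] -/
def coneNuPoly : MvPolynomial (Fin n) k :=
  (∏ l ∈ I.erase i, (1 - X i ^ (p - 1) * X l + X l ^ p)) *
    ∏ l ∈ Finset.univ \ I, (1 - X i ^ (p - 1) * X l ^ (p - 1) + X l ^ p)

omit [CharP k p] in
/-- The `K`-factors lie in the cone. [OURS · L1 W4.5c] -/
theorem nuKPoly_mem (hi : i ∈ I) {l : Fin n} (hl : l ∈ I) :
    (1 - X i ^ (p - 1) * X l + X l ^ p : MvPolynomial (Fin n) k) ∈ PthCone.cone k n p (chartWeight p n I) := by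
  have hp1 : p - 1 + 1 = p := Nat.sub_add_cancel (Fact.out : p.Prime).one_le
  refine Subalgebra.add_mem _ (Subalgebra.sub_mem _ (Subalgebra.one_mem _) ?_)
    (PthCone.X_pow_mem_cone_of_dvd k n p _ l (dvd_refl p))
  have hmono : (X i ^ (p - 1) * X l : MvPolynomial (Fin n) k) =
      monomial (Finsupp.single i (p - 1) + Finsupp.single l 1) 1 := by
    rw [X_pow_eq_monomial, X, monomial_mul, one_mul]
  rw [hmono]
  refine PthCone.monomial_mem_cone k n p _ ?_ 1
  rw [weight_chartWeight_eq, twistDeg_add, twistDeg_single_of_mem n I hi, twistDeg_single_of_mem n I hl]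
  push_cast [Nat.cast_sub (Fact.out : p.Prime).one_le]
  rw [sub_add_cancel, ZMod.natCast_self]

omit [CharP k p] in
/-- The `J`-factors lie in the cone. [OURS · L1 W4.5c] -/
theorem nuJPoly_mem (hi : i ∈ I) {l : Fin n} (hl : l ∉ I) :
    (1 - X i ^ (p - 1) * X l ^ (p - 1) + X l ^ p : MvPolynomial (Fin n) k) ∈
      PthCone.cone k n p (chartWeight p n I) := by
  refine Subalgebra.add_mem _ (Subalgebra.sub_mem _ (Subalgebra.one_mem _) ?_)
    (PthCone.X_pow_mem_cone_of_dvd k n p _ l (dvd_refl p))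
  have hmono : (X i ^ (p - 1) * X l ^ (p - 1) : MvPolynomial (Fin n) k) =
      monomial (Finsupp.single i (p - 1) + Finsupp.single l (p - 1)) 1 := by
    rw [X_pow_eq_monomial, X_pow_eq_monomial, monomial_mul, one_mul]
  rw [hmono]
  refine PthCone.monomial_mem_cone k n p _ ?_ 1
  rw [weight_chartWeight_eq, twistDeg_add, twistDeg_single_of_mem n I hi, twistDeg_single_of_not_mem n I hl]
  simp

omit [CharP k p] in
/-- `coneNuPoly` lies in the cone. [OURS · L1 W4.5c] -/
theorem coneNuPoly_mem (hi : i ∈ I) : coneNuPoly k p n i I ∈ PthCone.cone k n p (chartWeight p n I) := by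
  unfold coneNuPoly
  refine Subalgebra.mul_mem _ (Subalgebra.prod_mem _ fun l hl => nuKPoly_mem k p n i I hi (Finset.mem_of_mem_erase hl))
    (Subalgebra.prod_mem _ fun l hl => nuJPoly_mem k p n i I hi (Finset.mem_sdiff.mp hl).2)

/-- **The cone element `ν`** with `ψ₀(ν) = N'`. [OURS · L1 W4.5c] -/
def coneNu (hi : i ∈ I) : PthCone.cone k n p (chartWeight p n I) := ⟨coneNuPoly k p n i I, coneNuPoly_mem k p n i I hi⟩

omit [CharP k p] in
/-- `ψ₀` on a cone element, summed over the support of its underlying polynomial.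
[OURS · L1 W4.5c] -/
theorem psi0_eq_sum (f : PthCone.cone k n p (chartWeight p n I)) :
    psi0 k p n i I f = ∑ d ∈ (f : MvPolynomial (Fin n) k).support,
      algebraMap (MvPolynomial (Fin n) k) (ChartRing k p n i I) (monomial d (coeff d (f : MvPolynomial (Fin n) k))) *
        ↑(chartUUnit k p n i I ^ (-coneDeg n p I d)) := by
  classical
  let μ : (Fin n →₀ ℕ) → PthCone.cone k n p (chartWeight p n I) := fun d =>
    if hd : Finsupp.weight (chartWeight p n I) d = 0 then coneMonomial k n p _ d hd else 0
  have hμ : ∀ (d : Fin n →₀ ℕ) (hd : Finsupp.weight (chartWeight p n I) d = 0),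
      μ d = PthCone.monomialElem k n p _ d hd := by
    intro d hd; simp only [μ, dif_pos hd]; rfl
  conv_lhs => rw [PthCone.eq_sum_coeff_smul k n p _ f μ hμ]
  rw [map_sum]
  refine Finset.sum_congr rfl fun d hd => ?_
  have hwd : Finsupp.weight (chartWeight p n I) d = 0 :=
    (PthCone.mem_cone_iff k n p _ _).mp f.2 (mem_support_iff.mp hd)
  have : μ d = coneMonomial k n p _ d hwd := by simp only [μ, dif_pos hwd]
  rw [this, psi0_smul_coneMonomial]

omit [CharP k p] in
/-- The `K`-factor as a cone element is `1 − x^{d₁} + x^{d₂}`. [OURS · L1 W4.5c] -/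
theorem psi0_nuKCone (hi : i ∈ I) {l : Fin n} (hl : l ∈ I) :
    psi0 k p n i I ⟨1 - X i ^ (p - 1) * X l + X l ^ p, nuKPoly_mem k p n i I hi hl⟩ = nuK k p n i I l := by
  have hp0 : (p : ℤ) ≠ 0 := by exact_mod_cast (Fact.out : p.Prime).ne_zero
  have hp1 : p - 1 + 1 = p := Nat.sub_add_cancel (Fact.out : p.Prime).one_le
  -- weights and degrees of the two monomials
  have hw1 : Finsupp.weight (chartWeight p n I) (Finsupp.single i (p - 1) + Finsupp.single l 1) = 0 := by
    rw [weight_chartWeight_eq, twistDeg_add, twistDeg_single_of_mem n I hi, twistDeg_single_of_mem n I hl]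
    push_cast [Nat.cast_sub (Fact.out : p.Prime).one_le]
    rw [sub_add_cancel, ZMod.natCast_self]
  have hw2 : Finsupp.weight (chartWeight p n I) (Finsupp.single l p) = 0 := by
    rw [weight_chartWeight_eq, twistDeg_single_of_mem n I hl, Int.cast_natCast, ZMod.natCast_self]
  have hd1 : coneDeg n p I (Finsupp.single i (p - 1) + Finsupp.single l 1) = 1 := by
    have h := twistDeg_eq_mul_coneDeg n p I _ hw1
    rw [twistDeg_add, twistDeg_single_of_mem n I hi, twistDeg_single_of_mem n I hl] at h
    push_cast [Nat.cast_sub (Fact.out : p.Prime).one_le] at h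
    have : (p : ℤ) * 1 = p * coneDeg n p I (Finsupp.single i (p - 1) + Finsupp.single l 1) := by linarith
    exact (mul_left_cancel₀ hp0 this).symm
  have hd2 : coneDeg n p I (Finsupp.single l p) = 1 := by
    have h := twistDeg_eq_mul_coneDeg n p I _ hw2
    rw [twistDeg_single_of_mem n I hl] at h
    have : (p : ℤ) * 1 = p * coneDeg n p I (Finsupp.single l p) := by linarith
    exact (mul_left_cancel₀ hp0 this).symm
  -- decompose the cone element
  have hdec : (⟨1 - X i ^ (p - 1) * X l + X l ^ p, nuKPoly_mem k p n i I hi hl⟩ :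
      PthCone.cone k n p (chartWeight p n I)) =
      1 - coneMonomial k n p _ _ hw1 + coneMonomial k n p _ _ hw2 := by
    apply Subtype.ext
    change (1 - X i ^ (p - 1) * X l + X l ^ p : MvPolynomial (Fin n) k) = _
    rw [Subalgebra.coe_add, Subalgebra.coe_sub, Subalgebra.coe_one, coe_coneMonomial, coe_coneMonomial,
      X_pow_eq_monomial, X_pow_eq_monomial, X, monomial_mul, one_mul]
  rw [hdec, map_add, map_sub, map_one, psi0_coneMonomial, psi0_coneMonomial, hd1, hd2,
    show (-(1 : ℤ)) = -((1 : ℕ) : ℤ) by norm_num, val_chartUUnit_zpow_neg_natCast, pow_one,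
    ← X_pow_eq_monomial, map_pow, nuK]
  rw [show monomial (Finsupp.single i (p - 1) + Finsupp.single l 1) (1 : k) = X i ^ (p - 1) * X l by
    rw [X_pow_eq_monomial, X, monomial_mul, one_mul], map_mul, map_pow]

omit [CharP k p] in
/-- The `J`-factor as a cone element. [OURS · L1 W4.5c] -/
theorem psi0_nuJCone (hi : i ∈ I) {l : Fin n} (hl : l ∉ I) :
    psi0 k p n i I ⟨1 - X i ^ (p - 1) * X l ^ (p - 1) + X l ^ p, nuJPoly_mem k p n i I hi hl⟩ =
      nuJ k p n i I l := by
  have hp0 : (p : ℤ) ≠ 0 := by exact_mod_cast (Fact.out : p.Prime).ne_zero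
  have hw1 : Finsupp.weight (chartWeight p n I) (Finsupp.single i (p - 1) + Finsupp.single l (p - 1)) = 0 := by
    rw [weight_chartWeight_eq, twistDeg_add, twistDeg_single_of_mem n I hi, twistDeg_single_of_not_mem n I hl]
    simp
  have hw2 : Finsupp.weight (chartWeight p n I) (Finsupp.single l p) = 0 := by
    rw [weight_chartWeight_eq, twistDeg_single_of_not_mem n I hl, Int.cast_neg, Int.cast_natCast,
      ZMod.natCast_self, neg_zero]
  have hd1 : coneDeg n p I (Finsupp.single i (p - 1) + Finsupp.single l (p - 1)) = 0 := by
    have h := twistDeg_eq_mul_coneDeg n p I _ hw1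
    rw [twistDeg_add, twistDeg_single_of_mem n I hi, twistDeg_single_of_not_mem n I hl] at h
    have : (p : ℤ) * 0 = p * coneDeg n p I (Finsupp.single i (p - 1) + Finsupp.single l (p - 1)) := by
      linarith
    exact (mul_left_cancel₀ hp0 this).symm
  have hd2 : coneDeg n p I (Finsupp.single l p) = -1 := by
    have h := twistDeg_eq_mul_coneDeg n p I _ hw2
    rw [twistDeg_single_of_not_mem n I hl] at h
    have : (p : ℤ) * (-1) = p * coneDeg n p I (Finsupp.single l p) := by linarith
    exact (mul_left_cancel₀ hp0 this).symm
  have hdec : (⟨1 - X i ^ (p - 1) * X l ^ (p - 1) + X l ^ p, nuJPoly_mem k p n i I hi hl⟩ :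
      PthCone.cone k n p (chartWeight p n I)) =
      1 - coneMonomial k n p _ _ hw1 + coneMonomial k n p _ _ hw2 := by
    apply Subtype.ext
    change (1 - X i ^ (p - 1) * X l ^ (p - 1) + X l ^ p : MvPolynomial (Fin n) k) = _
    rw [Subalgebra.coe_add, Subalgebra.coe_sub, Subalgebra.coe_one, coe_coneMonomial, coe_coneMonomial,
      X_pow_eq_monomial, X_pow_eq_monomial, X_pow_eq_monomial, monomial_mul, one_mul]
  rw [hdec, map_add, map_sub, map_one, psi0_coneMonomial, psi0_coneMonomial, hd1, hd2, neg_zero,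
    zpow_zero, Units.val_one, mul_one, neg_neg, show (1 : ℤ) = ((1 : ℕ) : ℤ) by norm_num,
    val_chartUUnit_zpow_natCast, pow_one, ← X_pow_eq_monomial, map_pow, nuJ]
  rw [show monomial (Finsupp.single i (p - 1) + Finsupp.single l (p - 1)) (1 : k) = X i ^ (p - 1) * X l ^ (p - 1) by
    rw [X_pow_eq_monomial, X_pow_eq_monomial, monomial_mul, one_mul], map_mul, map_pow, map_pow, mul_pow]

omit [CharP k p] in
/-- **`ψ₀(ν) = N'`.** [OURS · L1 W4.5c] -/
theorem psi0_coneNu (hi : i ∈ I) : psi0 k p n i I (coneNu k p n i I hi) = chartNu k p n i I := by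
  classical
  let fK : Fin n → PthCone.cone k n p (chartWeight p n I) := fun l =>
    if hl : l ∈ I then ⟨_, nuKPoly_mem k p n i I hi hl⟩ else 1
  let fJ : Fin n → PthCone.cone k n p (chartWeight p n I) := fun l =>
    if hl : l ∉ I then ⟨_, nuJPoly_mem k p n i I hi hl⟩ else 1
  have hfac : coneNu k p n i I hi = (∏ l ∈ I.erase i, fK l) * ∏ l ∈ Finset.univ \ I, fJ l := by
    apply Subtype.ext
    rw [Subalgebra.coe_mul, SubmonoidClass.coe_finsetProd, SubmonoidClass.coe_finsetProd]
    change coneNuPoly k p n i I = _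
    unfold coneNuPoly
    congr 1
    · refine Finset.prod_congr rfl fun l hl => ?_
      simp only [fK, dif_pos (Finset.mem_of_mem_erase hl)]
    · refine Finset.prod_congr rfl fun l hl => ?_
      simp only [fJ, dif_pos (Finset.mem_sdiff.mp hl).2]
  rw [hfac, map_mul, map_prod, map_prod, chartNu]
  congr 1
  · refine Finset.prod_congr rfl fun l hl => ?_
    have hlI : l ∈ I := Finset.mem_of_mem_erase hl
    simp only [fK, dif_pos hlI]
    exact psi0_nuKCone k p n i I hi hlI
  · refine Finset.prod_congr rfl fun l hl => ?_
    have hlI : l ∉ I := (Finset.mem_sdiff.mp hl).2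
    simp only [fJ, dif_pos hlI]
    exact psi0_nuJCone k p n i I hi hlI

/-- `ψ₀(ν)` is a unit. [OURS · L1 W4.5c] -/
theorem isUnit_psi0_coneNu (hi : i ∈ I) : IsUnit (psi0 k p n i I (coneNu k p n i I hi)) := by
  rw [psi0_coneNu]; exact isUnit_chartNu k p n i I

end Presentation

end Summit.ResolutionOfSingularities.ResolutionOfSingularities.Theorems.WildQuotientResolution.ConductorOne

end
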